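import Mathlib
import Literature.Combinatorics.Optimization.GrigorievSchoenebeckPseudoDensity
import Literature.Combinatorics.Optimization.RandomThreeCnfValueCount
import Literature.Combinatorics.Optimization.MaxThreeXorLpLowerBound

/-!
# The Grigoriev–Schoenebeck sum-of-squares gaps for Max-3SAT and Max-3XOR:
# `Schoenebeck2008_maxThreeSatSos` and `Schoenebeck2008_maxThreeXorSA` DISCHARGED

The two Grigoriev/Schoenebeck-named facts of the psd-rank / LP-size layer,

* `Schoenebeck2008_maxThreeSatSos` (`SDPRelaxationsMaxCSP.lean`; the input "Thm 6.5" of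
  Lee–Raghavendra–Steurer 2015: for every `ε > 0` there are `c_ε > 0`, `n₀` such that for all
  `n ≥ n₀` some Max-3SAT instance on `n` variables has `opt ≤ 7/8 + ε` but no bound `c < 1` has a
  degree-`⌊c_ε n⌋` sum-of-squares certificate), and
* `Schoenebeck2008_maxThreeXorSA` (`MaxThreeXorLpLowerBound.lean`; the input "Thm 7.5" of
  Kothari–Meka–Raghavendra 2017: degree-`⌊c_ε n⌋` Sherali–Adams does not achieve a
  `(1 − ε, 1/2 + ε)`-approximation of Max-3XOR on `n` variables, `n ≥ n₀`),

are PROVED here (`Schoenebeck2008_maxThreeSatSos_holds`, `Schoenebeck2008_maxThreeXorSA_holds`),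
following Fleming–Kothari–Pitassi 2019, §5.1 (Thm 5.2 = Grigoriev 2001 / Schoenebeck 2008):

1. **Good clause tuples exist** (`exists_good_tuple`): for `Δ = ⌈16/ε²⌉` and all large `n`, some
   tuple `ω` of `m = Δ n` clauses from `kClauses 3 n` is simultaneously a `(⌊κ n⌋, 7/4)`-cover
   expander (the tree's first-moment count `card_le_of_forall_not_isCoverExpander_linear`,
   Chvátal–Szemerédi / FKP19 Lemma 5.9), has every assignment satisfying `≤ (7/8 + ε) m` of its
   clauses, and every assignment satisfying `≤ (1/2 + ε) m` of its first-literal parity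
   constraints (FKP19 Lemma 5.3 as the counts `card_filter_exists_manyGood_le` of
   `RandomThreeCnfValueCount.lean`) — three bad sets of total size `< |kClauses 3 n|^m`.
2. **Expansion ⇒ pseudo-density** (`GrigorievSchoenebeckPseudoDensity.lean` on top of the tree's
   `XorDerivation`/`XorPseudoexpectation`): cover expansion `7/4` gives boundary expansion `1/2`
   (`IsCoverExpander.isBoundaryExpander`), hence `(⌊κn⌋, 1/2)`-vector expansion of the scope
   vectors (`vecExpands_tupleVecs`), hence for `d ≤ ⌊κ n⌋/4` the Grigoriev–Schoenebeck
   pseudo-density of degree `d` (`isPseudoDensity_gsDensity`), which gives every clause of the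
   tuple (resp. every parity constraint) pseudo-expectation `1`
   (`cubeExpect_gsDensity_mul_unsatInd`, `cubeExpect_gsDensity_mul_xorSatInd`), so
   `E D · (c − val) = c − 1 < 0` and no degree-`d` certificate exists
   (`IsPseudoDensity.cubeExpect_mul_nonneg`).
3. For 3XOR, the sum-of-squares failure at degree `2d` gives the Sherali–Adams failure at degree
   `d` by the tree's bridge `SAAchieves.achievesApprox` (KMR Fact 3.4).

No new definitions of facts; net debt −2.

## References

* N. Fleming, P. Kothari, T. Pitassi, *Semialgebraic Proofs and Efficient Algorithm Design*,
  Found. Trends TCS 14 (2019), §5.1: Thm 5.2, Lemmas 5.3, 5.6, 5.7, 5.9 and p. 154 (3SAT)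
  [FlemingKothariPitassi2019]; held text `paper:galaxy-pdf-4841134338957687840`, pp. 147–154.
* D. Grigoriev, *Linear lower bound on degrees of Positivstellensatz calculus proofs for the
  parity*, Theoret. Comput. Sci. 259 (2001) 613–622 [Grigoriev2001TCS].
* G. Schoenebeck, *Linear level Lasserre lower bounds for certain k-CSPs*, FOCS 2008, Thm 4.1, §5.
* J. R. Lee, P. Raghavendra, D. Steurer, STOC 2015, Thm 6.5 [LeeRaghavendraSteurer2015];
  P. Kothari, R. Meka, P. Raghavendra, STOC 2017, Thm 7.5 [KothariMekaRaghavendra2017].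
-/

noncomputable section

open Finset
open Literature.Probability.RandomGraphs.LowDegree (walsh sgn)
open Literature.Computability.Complexity (Literal Clause kClauses clauseOf)
open Literature.Computability.MetaComplexity (ParityVec indVec clauseScope clauseVec clauseSign
  litVec IsCoverExpander VecExpands clauseVec_eq_indVec vecExpands_of_isBoundaryExpander
  nodup_map_fst_of_mem_kClauses card_clauseScope_of_mem_kClauses card_kClauses clauseSign_mul_self
  indVec_eq_sum card_le_of_forall_not_isCoverExpander_linear)

namespace Literature.Combinatorics.Optimization

variable {n m : ℕ}

/-! ### The Grigoriev–Schoenebeck family of a clause tuple -/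

/-- The scope vectors of a clause tuple. [cite: FlemingKothariPitassi2019, §5.1 (Def. 5.1, p. 147)] -/
def tupleVecs (ω : Fin m → ↥(kClauses 3 n)) : Fin m → ParityVec := fun i => clauseVec (ω i).1

/-- The parity signs `−∏_j s_j` of the clauses (odd number of true literals).
[cite: FlemingKothariPitassi2019, §5.1 (p. 154: "define `φ_⊕`")] -/
def tupleSatSigns (ω : Fin m → ↥(kClauses 3 n)) : Fin m → ℝ := fun i => clauseSign (ω i).1

/-- The first-literal signs of the clauses (the right-hand sides of the 3XOR instance).
[cite: FlemingKothariPitassi2019, §5.1 (Def. 5.1: `b_{ijk}`)] -/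
def tupleXorSigns (ω : Fin m → ↥(kClauses 3 n)) : Fin m → ℝ := fun i => xorSign (ω i)

/-- The scope vector of a `3`-clause is the parity vector of its scope `scope3`.
[cite: FlemingKothariPitassi2019, §5.1 (Def. 5.4)] -/
theorem toVec_scope3 (C : ↥(kClauses 3 n)) : toVec (scope3 C) = clauseVec C.1 := by
  classical
  have hlen := length_of_mem_kClauses C.2
  rw [toVec, indVec_eq_sum, clauseVec, litVec, scope3, Finset.map_eq_image, Finset.image_image,
    Finset.sum_image]
  · -- both sides are the sum of the unit vectors of the three variables
    rw [← Equiv.sum_comp (finCongr hlen.symm)]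
    rfl
  · intro j₁ _ j₂ _ h
    exact var3_injective C (Fin.ext (by simpa [var3] using h))

/-- `tupleVecs ω i = toVec (scope3 (ω i))`. [cite: FlemingKothariPitassi2019, §5.1 (Def. 5.4)] -/
theorem tupleVecs_eq (ω : Fin m → ↥(kClauses 3 n)) (i : Fin m) :
    tupleVecs ω i = toVec (scope3 (ω i)) :=
  (toVec_scope3 (ω i)).symm

/-- **Cover expansion `7/4` of the scopes gives `(N, 1/2)`-vector expansion of the scope vectors**
(`|∂F| ≥ 2·(7/4)|F| − 3|F| = |F|/2`, and unique neighbours have odd degree).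
[cite: FlemingKothariPitassi2019, §5.1 (p. 152: "(t, 2β − 3)-boundary expander", δ = 0.25)] -/
theorem vecExpands_tupleVecs (ω : Fin m → ↥(kClauses 3 n)) {N : ℝ}
    (hexp : IsCoverExpander (fun i => clauseScope (ω i).1) N (7 / 4)) :
    VecExpands (tupleVecs ω) N (1 / 2) := by
  classical
  have hk : ∀ i, (clauseScope (ω i).1).card ≤ 3 := fun i =>
    (card_clauseScope_of_mem_kClauses (ω i).2).le
  have hexp' : IsCoverExpander (fun i => clauseScope (ω i).1) N (((3 : ℕ) + (1 / 2 : ℝ)) / 2) := by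
    convert hexp using 1; norm_num
  have hB := Literature.Computability.MetaComplexity.IsCoverExpander.isBoundaryExpander hk hexp'
  have hV := vecExpands_of_isBoundaryExpander hB
  have hfun : tupleVecs ω = fun i => indVec (clauseScope (ω i).1) := by
    funext i
    exact clauseVec_eq_indVec (nodup_map_fst_of_mem_kClauses (ω i).2)
  rw [hfun]
  exact hV

/-! ### Good clause tuples exist (FKP19 Lemmas 5.3 and 5.9, by counting) -/

/-- `2ⁿ e^{−2n} ≤ 2/7` for `n ≥ 1` (`e² > 7`). [cite: FlemingKothariPitassi2019, §5.1 (Lemma 5.3: "makes this probability less than 2^{−n}")] -/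
theorem two_pow_mul_exp_neg_two_mul_le {n : ℕ} (hn : 1 ≤ n) :
    (2 : ℝ) ^ n * Real.exp (-(2 * n)) ≤ 2 / 7 := by
  have he : (7 : ℝ) < Real.exp 2 := by
    have h := Real.exp_one_gt_d9
    have : Real.exp 2 = Real.exp 1 * Real.exp 1 := by rw [← Real.exp_add]; norm_num
    rw [this]; nlinarith
  have h1 : (2 : ℝ) ^ n * Real.exp (-(2 * n)) = (2 / Real.exp 2) ^ n := by
    rw [div_pow, Real.exp_neg, ← Real.exp_nat_mul, div_eq_mul_inv]
    ring_nf
  rw [h1]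
  have h2 : (2 : ℝ) / Real.exp 2 ≤ 2 / 7 :=
    div_le_div_of_nonneg_left (by norm_num) (by norm_num) he.le
  have h3 : (0 : ℝ) ≤ 2 / Real.exp 2 := by positivity
  calc (2 / Real.exp 2) ^ n ≤ 2 / Real.exp 2 :=
        pow_le_of_le_one h3 (h2.trans (by norm_num)) (by omega)
    _ ≤ 2 / 7 := h2

/-- **Good tuples exist.** For `0 < ε ≤ 1` there are `Δ ≥ 1`, `κ > 0` and `n₀` such that for
every `n ≥ n₀` some tuple `ω` of `Δ n` clauses from `kClauses 3 n` has: (i) `(⌊κn⌋, 7/4)`-cover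
expanding scopes, (ii) every assignment satisfies at most `(7/8 + ε) Δn` of its clauses, (iii)
every assignment satisfies at most `(1/2 + ε) Δn` of its first-literal parity constraints — the
three failure counts (`card_le_of_forall_not_isCoverExpander_linear`;
`card_filter_exists_manyGood_le` with `p = 7/8` and `p = 1/2`) add up to less than the number of
tuples. [cite: FlemingKothariPitassi2019, §5.1 (Lemma 5.3 and Lemma 5.9, pp. 148, 152)] -/
theorem exists_good_tuple {ε : ℝ} (hε0 : 0 < ε) (hε1 : ε ≤ 1) :
    ∃ Δ : ℕ, 1 ≤ Δ ∧ ∃ κ : ℝ, 0 < κ ∧ ∃ n₀ : ℕ, ∀ n : ℕ, n₀ ≤ n →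
      ∃ ω : Fin (Δ * n) → ↥(kClauses 3 n),
        IsCoverExpander (fun i => clauseScope (ω i).1) (⌊κ * n⌋₊ : ℕ) (7 / 4) ∧
        (∀ x : Fin n → Bool, ((univ.filter fun i : Fin (Δ * n) =>
            Literature.Computability.Complexity.Clause.eval (extAssign x) (ω i).1 = true).card : ℝ) ≤
          (7 / 8 + ε) * (Δ * n : ℕ)) ∧
        (∀ x : Fin n → Bool, ((univ.filter fun i : Fin (Δ * n) =>
            walsh (scope3 (ω i)) x = xorSign (ω i)).card : ℝ) ≤ (1 / 2 + ε) * (Δ * n : ℕ)) := by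
  classical
  -- constants
  set Δ : ℕ := ⌈16 / ε ^ 2⌉₊ with hΔdef
  have hΔ16 : 16 / ε ^ 2 ≤ (Δ : ℝ) := Nat.le_ceil _
  have hε2 : 0 < ε ^ 2 := by positivity
  have hΔ1 : 1 ≤ Δ := by
    have : (16 : ℝ) ≤ 16 / ε ^ 2 := by
      rw [le_div_iff₀ hε2]; nlinarith
    have h : (1 : ℝ) ≤ Δ := by linarith
    exact_mod_cast h
  set a : ℝ := 7 / 4 with ha
  set B : ℝ := Real.exp (1 + a) * Δ * a with hB
  have hBpos : 0 < B := by rw [hB]; positivity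
  set κ : ℝ := 1 / (a * (2 * B) ^ 4) with hκ
  have hκpos : 0 < κ := by rw [hκ]; positivity
  refine ⟨Δ, hΔ1, κ, hκpos, max 3 ⌈128 * a * B ^ 4⌉₊, fun n hn => ?_⟩
  have hn3 : 3 ≤ n := le_of_max_le_left hn
  have hn1 : 1 ≤ n := by omega
  have hnr : (0 : ℝ) < n := by exact_mod_cast hn1
  have hnB : 128 * a * B ^ 4 ≤ n := (Nat.le_ceil _).trans (by exact_mod_cast le_of_max_le_right hn)
  -- the clause space
  have hKc : (kClauses 3 n).card = n.choose 3 * 8 := by rw [card_kClauses]; norm_num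
  have hK : (kClauses 3 n).Nonempty := by
    rw [← Finset.card_pos, hKc]
    exact Nat.mul_pos (Nat.choose_pos hn3) (by norm_num)
  set X := ↥(kClauses 3 n)
  set m := Δ * n with hm
  have hcardX : (Fintype.card X : ℝ) = (kClauses 3 n).card := by rw [Fintype.card_coe]
  set T : ℝ := ((kClauses 3 n).card : ℝ) ^ m with hT
  have hTpos : 0 < T := by rw [hT]; exact pow_pos (by exact_mod_cast Finset.card_pos.2 hK) _
  -- the three bad sets
  set badExp : Finset (Fin m → X) := univ.filter fun ω =>
    ¬ IsCoverExpander (fun i => clauseScope (ω i).1) (⌊κ * n⌋₊ : ℕ) (7 / 4) with hbadExp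
  set badSat : Finset (Fin m → X) := univ.filter fun ω => ∃ σ : Fin n → Bool,
    (7 / 8 + ε) * m < ((univ.filter fun i =>
      Literature.Computability.Complexity.Clause.eval (extAssign σ) (ω i).1 = true).card : ℝ)
    with hbadSat
  set badXor : Finset (Fin m → X) := univ.filter fun ω => ∃ σ : Fin n → Bool,
    (1 / 2 + ε) * m < ((univ.filter fun i => walsh (scope3 (ω i)) σ = xorSign (ω i)).card : ℝ)
    with hbadXor
  -- (1) expansion failures
  have h1 : (badExp.card : ℝ) ≤ T / 4 := by
    have hN : a * (⌊κ * n⌋₊ : ℕ) ≤ n / (2 * B) ^ 4 := by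
      have hf : ((⌊κ * n⌋₊ : ℕ) : ℝ) ≤ κ * n := Nat.floor_le (by positivity)
      have : a * (κ * n) = n / (2 * B) ^ 4 := by
        rw [hκ]; field_simp
      calc a * (⌊κ * n⌋₊ : ℕ) ≤ a * (κ * n) := by rw [ha]; gcongr
        _ = n / (2 * B) ^ 4 := this
    have h := card_le_of_forall_not_isCoverExpander_linear (k := 3) (Δ := Δ) (n := n)
      (N := ⌊κ * n⌋₊) (a := a) (B := B) le_rfl hΔ1 hn1 hK (by rw [ha]; norm_num) hB hN badExp
      (fun c hc => (Finset.mem_filter.1 hc).2)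
    have hcoef : 32 * a * B ^ 4 / n ≤ 1 / 4 := by
      rw [div_le_iff₀ hnr]
      calc (32 : ℝ) * a * B ^ 4 = 1 / 4 * (128 * a * B ^ 4) := by ring
        _ ≤ 1 / 4 * (n : ℝ) := by gcongr
    calc (badExp.card : ℝ) ≤ 32 * a * B ^ 4 / n * ((((kClauses 3 n).card ^ (Δ * n) : ℕ)) : ℝ) := h
      _ ≤ 1 / 4 * T := by
          rw [hT, hm]; push_cast
          exact mul_le_mul_of_nonneg_right hcoef (by positivity)
      _ = T / 4 := by ring
  -- the exponential factor
  have hexpfac : ∀ q : ℝ, 2 ≤ q * (Δ : ℝ) →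
      (2 : ℝ) ^ n * Real.exp (-(q * (m : ℕ))) ≤ 2 / 7 := by
    intro q hq
    have h2n := two_pow_mul_exp_neg_two_mul_le hn1
    have : Real.exp (-(q * (m : ℕ))) ≤ Real.exp (-(2 * n)) := by
      rw [Real.exp_le_exp, hm]; push_cast; nlinarith
    calc (2 : ℝ) ^ n * Real.exp (-(q * (m : ℕ))) ≤ 2 ^ n * Real.exp (-(2 * n)) := by gcongr
      _ ≤ 2 / 7 := h2n
  -- (2) 3SAT value failures
  have h2 : (badSat.card : ℝ) ≤ 2 / 7 * T := by
    have h := card_filter_exists_manyGood_le (n := n) (X := X)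
      (fun σ C => Literature.Computability.Complexity.Clause.eval (extAssign σ) C.1 = true)
      (p := 7 / 8) (ε := ε) (by norm_num) (fun σ => card_filter_satGood_le (extAssign σ))
      hε0.le hε1 m
    rw [hcardX] at h
    have hq : (2 : ℝ) ≤ (1 - 7 / 8) * ε ^ 2 * Δ := by
      have : (16 : ℝ) ≤ ε ^ 2 * Δ := by
        calc (16 : ℝ) = ε ^ 2 * (16 / ε ^ 2) := by field_simp
          _ ≤ ε ^ 2 * Δ := by gcongr
      linarith
    have h3 := hexpfac ((1 - 7 / 8) * ε ^ 2) hq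
    calc (badSat.card : ℝ) ≤ 2 ^ n * (((kClauses 3 n).card : ℝ) ^ m *
          Real.exp (-((1 - 7 / 8) * ε ^ 2 * m))) := h
      _ = 2 ^ n * Real.exp (-((1 - 7 / 8) * ε ^ 2 * (m : ℕ))) * T := by rw [hT]; ring
      _ ≤ 2 / 7 * T := mul_le_mul_of_nonneg_right h3 hTpos.le
  -- (3) 3XOR value failures
  have h3 : (badXor.card : ℝ) ≤ 2 / 7 * T := by
    have h := card_filter_exists_manyGood_le (n := n) (X := X)
      (fun σ C => walsh (scope3 C) σ = xorSign C)
      (p := 1 / 2) (ε := ε) (by norm_num) (fun σ => card_filter_xorGood_le σ) hε0.le hε1 m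
    rw [hcardX] at h
    have hq : (2 : ℝ) ≤ (1 - 1 / 2) * ε ^ 2 * Δ := by
      have : (16 : ℝ) ≤ ε ^ 2 * Δ := by
        calc (16 : ℝ) = ε ^ 2 * (16 / ε ^ 2) := by field_simp
          _ ≤ ε ^ 2 * Δ := by gcongr
      linarith
    have h4 := hexpfac ((1 - 1 / 2) * ε ^ 2) hq
    calc (badXor.card : ℝ) ≤ 2 ^ n * (((kClauses 3 n).card : ℝ) ^ m *
          Real.exp (-((1 - 1 / 2) * ε ^ 2 * m))) := h
      _ = 2 ^ n * Real.exp (-((1 - 1 / 2) * ε ^ 2 * (m : ℕ))) * T := by rw [hT]; ring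
      _ ≤ 2 / 7 * T := mul_le_mul_of_nonneg_right h4 hTpos.le
  -- a tuple outside the three bad sets
  have hlt : ((badExp ∪ badSat ∪ badXor).card : ℝ) < (univ : Finset (Fin m → X)).card := by
    have hU : ((univ : Finset (Fin m → X)).card : ℝ) = T := by
      rw [Finset.card_univ, Fintype.card_fun, Fintype.card_fin, hT, Nat.cast_pow, hcardX]
    have hu : ((badExp ∪ badSat ∪ badXor).card : ℝ) ≤ badExp.card + badSat.card + badXor.card := by
      have := (Finset.card_union_le (badExp ∪ badSat) badXor).trans
        (Nat.add_le_add_right (Finset.card_union_le badExp badSat) _)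
      exact_mod_cast this
    rw [hU]
    linarith
  have hne : ((univ : Finset (Fin m → X)) \ (badExp ∪ badSat ∪ badXor)).Nonempty := by
    rw [Finset.nonempty_iff_ne_empty]
    intro h
    have := Finset.card_sdiff_add_card_eq_card (Finset.subset_univ (badExp ∪ badSat ∪ badXor))
    rw [h, Finset.card_empty, zero_add] at this
    rw [this] at hlt
    exact lt_irrefl _ hlt
  obtain ⟨ω, hω⟩ := hne
  rw [Finset.mem_sdiff, Finset.mem_union, Finset.mem_union, not_or, not_or] at hω
  obtain ⟨-, ⟨hωE, hωS⟩, hωX⟩ := hω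
  refine ⟨ω, ?_, fun x => ?_, fun x => ?_⟩
  · by_contra hc
    exact hωE (Finset.mem_filter.2 ⟨Finset.mem_univ _, hc⟩)
  · by_contra hc
    push Not at hc
    exact hωS (Finset.mem_filter.2 ⟨Finset.mem_univ _, x, hc⟩)
  · by_contra hc
    push Not at hc
    exact hωX (Finset.mem_filter.2 ⟨Finset.mem_univ _, x, hc⟩)

/-! ### The pseudo-expectation of the value of the instances -/

/-- For a `(N, 7/4)`-cover expanding tuple and `d ≤ N/4` (`N ≥ 2`, `d ≥ 3`), the
Grigoriev–Schoenebeck pseudo-density of degree `d` with the parity signs gives the Max-3SAT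
instance pseudo-expected value `1`. [cite: FlemingKothariPitassi2019, §5.1 (p. 154: soundness of the 3XOR pseudo-expectation for `φ`)] -/
theorem cubeExpect_gsDensity_mul_satInstance_val (ω : Fin m → ↥(kClauses 3 n)) (hm : 0 < m)
    {N : ℝ} {d : ℕ} (hexp : IsCoverExpander (fun i => clauseScope (ω i).1) N (7 / 4))
    (hN : 2 ≤ N) (hd : (d : ℝ) ≤ 1 / 2 * N / 2) (hd3 : 3 ≤ d) :
    cubeExpect (fun x => gsDensity n (tupleVecs ω) (tupleSatSigns ω) N d x *
      (satInstance ω hm).val x) = 1 := by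
  classical
  have hvec := vecExpands_tupleVecs ω hexp
  have hc : (0 : ℝ) < 1 / 2 := by norm_num
  have hr0 : (0 : ℝ) ≤ N := by linarith
  have hb : ∀ i, tupleSatSigns ω i * tupleSatSigns ω i = 1 := fun i => clauseSign_mul_self _
  set D := gsDensity n (tupleVecs ω) (tupleSatSigns ω) N d with hD
  -- the value as `1 −` the average of the clause falsities
  have hval : ∀ x, (satInstance ω hm).val x = 1 - (1 / (m : ℝ)) * ∑ i : Fin m, unsatInd (ω i).1 x := by
    intro x
    unfold CSPInstance.val satInstance
    simp only
    have hmr : (m : ℝ) ≠ 0 := by exact_mod_cast hm.ne'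
    have hterm : ∀ i : Fin m, (if (satConstraint (ω i)).sat x then (1 : ℝ) else 0) =
        1 - unsatInd (ω i).1 x := by
      intro i
      rw [satConstraint_sat (ω i) x (extAssign x) (fun v h => extAssign_of_lt x h), unsatInd_eq]
      split_ifs <;> norm_num
    rw [Finset.sum_congr rfl fun i _ => hterm i, Finset.sum_sub_distrib, Finset.sum_const,
      Finset.card_univ, Fintype.card_fin, nsmul_eq_mul, mul_one]
    field_simp
  have hfun : (fun x => D x * (satInstance ω hm).val x) =
      fun x => D x * (1 - (1 / (m : ℝ)) * ∑ i : Fin m, unsatInd (ω i).1 x) := by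
    funext x; rw [hval x]
  rw [hfun, cubeExpect_mul_sub, cubeExpect_mul_const, cubeExpect_gsDensity hvec hc hd hr0,
    cubeExpect_mul_const_mul, cubeExpect_mul_finset_sum]
  have hzero : ∀ i ∈ (univ : Finset (Fin m)), cubeExpect (fun x => D x * unsatInd (ω i).1 x) = 0 := by
    intro i _
    exact cubeExpect_gsDensity_mul_unsatInd hvec hc hd hN hb (ω i).1
      (fst_lt_of_mem_kClauses (ω i).2) (nodup_map_fst_of_mem_kClauses (ω i).2)
      (by rw [length_of_mem_kClauses (ω i).2]; norm_num)
      (by rw [length_of_mem_kClauses (ω i).2]; exact hd3) i rfl rfl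
  rw [Finset.sum_congr rfl hzero, Finset.sum_const_zero, mul_zero, sub_zero, mul_one]

/-- Likewise, with the first-literal signs, the Max-3XOR instance has pseudo-expected value `1`
(`d ≥ 3`). [cite: FlemingKothariPitassi2019, §5.1 (Lemma 5.6, condition 4: `Ẽ[x_{ijk}] = b_{ijk}`)] -/
theorem cubeExpect_gsDensity_mul_xorInstance_val (ω : Fin m → ↥(kClauses 3 n)) (hm : 0 < m)
    {N : ℝ} {d : ℕ} (hexp : IsCoverExpander (fun i => clauseScope (ω i).1) N (7 / 4))
    (hN : 2 ≤ N) (hd : (d : ℝ) ≤ 1 / 2 * N / 2) (hd3 : 3 ≤ d) :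
    cubeExpect (fun x => gsDensity n (tupleVecs ω) (tupleXorSigns ω) N d x *
      (xorInstance ω hm).val x) = 1 := by
  classical
  have hvec := vecExpands_tupleVecs ω hexp
  have hc : (0 : ℝ) < 1 / 2 := by norm_num
  have hr0 : (0 : ℝ) ≤ N := by linarith
  have hb : ∀ i, tupleXorSigns ω i * tupleXorSigns ω i = 1 := fun i => xorSign_mul_self _
  set D := gsDensity n (tupleVecs ω) (tupleXorSigns ω) N d with hD
  have hval : ∀ x, (xorInstance ω hm).val x =
      (1 / (m : ℝ)) * ∑ i : Fin m, xorSatInd (scope3 (ω i)) (xorSign (ω i)) x := by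
    intro x
    unfold CSPInstance.val xorInstance
    simp only
    have hterm : ∀ i : Fin m, (if (xorConstraint (ω i)).sat x then (1 : ℝ) else 0) =
        xorSatInd (scope3 (ω i)) (xorSign (ω i)) x := by
      intro i
      rw [xorSatInd_eq_ite _ (mul_self_eq_one_iff.1 (xorSign_mul_self (ω i)))]
      by_cases h : walsh (scope3 (ω i)) x = xorSign (ω i)
      · rw [if_pos ((xorConstraint_sat_iff (ω i) x).2 h), if_pos h]
      · have : ¬ (xorConstraint (ω i)).sat x = true :=
          fun h' => h ((xorConstraint_sat_iff (ω i) x).1 h')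
        rw [if_neg this, if_neg h]
    rw [Finset.sum_congr rfl fun i _ => hterm i]
    field_simp
  have hfun : (fun x => D x * (xorInstance ω hm).val x) =
      fun x => D x * ((1 / (m : ℝ)) * ∑ i : Fin m, xorSatInd (scope3 (ω i)) (xorSign (ω i)) x) := by
    funext x; rw [hval x]
  rw [hfun, cubeExpect_mul_const_mul, cubeExpect_mul_finset_sum]
  have hone : ∀ i ∈ (univ : Finset (Fin m)),
      cubeExpect (fun x => D x * xorSatInd (scope3 (ω i)) (xorSign (ω i)) x) = 1 := by
    intro i _
    exact cubeExpect_gsDensity_mul_xorSatInd hvec hc hd hN hb i (scope3 (ω i)) (tupleVecs_eq ω i)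
      (by rw [card_scope3]; exact hd3)
  rw [Finset.sum_congr rfl hone, Finset.sum_const, Finset.card_univ, Fintype.card_fin,
    nsmul_eq_mul, mul_one]
  have hmr : (m : ℝ) ≠ 0 := by exact_mod_cast hm.ne'
  field_simp

/-! ### The two named facts, discharged -/

/-- Floors of linear functions: for `κ n ≥ 64`, `d = ⌊κ n / 32⌋` satisfies `3 ≤ d`, `2 ≤ d`,
`2d ≤ ⌊κn⌋/4` and `⌊κ n⌋ ≥ 2`. [cite: FlemingKothariPitassi2019, §5.1 (Lemma 5.7: "Gaussian width Ω(n)")] -/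
theorem degree_bookkeeping {κ : ℝ} {n : ℕ} (hκ : 0 < κ) (h : 64 ≤ κ * n) :
    2 ≤ ((⌊κ * n⌋₊ : ℕ) : ℝ) ∧ 2 ≤ ⌊κ / 32 * n⌋₊ ∧
      ((2 * ⌊κ / 32 * n⌋₊ : ℕ) : ℝ) ≤ 1 / 2 * ((⌊κ * n⌋₊ : ℕ) : ℝ) / 2 := by
  have hf1 : κ * n - 1 ≤ ((⌊κ * n⌋₊ : ℕ) : ℝ) := by
    have := Nat.lt_floor_add_one (κ * n); linarith
  have hf2 : ((⌊κ / 32 * n⌋₊ : ℕ) : ℝ) ≤ κ / 32 * n := Nat.floor_le (by positivity)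
  have hf3 : (2 : ℕ) ≤ ⌊κ / 32 * n⌋₊ := by
    refine Nat.le_floor ?_; push_cast; linarith
  refine ⟨by linarith, hf3, ?_⟩
  push_cast
  linarith

/-- **Schoenebeck 2008 / Grigoriev 2001 (as restated in Lee–Raghavendra–Steurer 2015, Thm 6.5):
linear-degree sum-of-squares does not beat `7/8` on Max 3-Sat — PROVED.** For every `ε > 0` there
are `c_ε > 0` and `n₀` such that for every `n ≥ n₀` some Max 3-Sat instance on `n` variables has
`opt ≤ 7/8 + ε` while no `c < 1` has a degree-`⌊c_ε n⌋` sum-of-squares certificate for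
`c − ℑ`. Proof: the good clause tuple of `exists_good_tuple` and the Grigoriev–Schoenebeck
pseudo-density (`isPseudoDensity_gsDensity`, `cubeExpect_gsDensity_mul_satInstance_val`) against
weak duality (`IsPseudoDensity.cubeExpect_mul_nonneg`).
[cite: FlemingKothariPitassi2019, §5.1 (Thm 5.2 with p. 154)]
[cite: LeeRaghavendraSteurer2015, Thm 6.5 (p. 26)] -/
theorem Schoenebeck2008_maxThreeSatSos_holds : Schoenebeck2008_maxThreeSatSos := by
  intro ε hε
  classical
  set ε' : ℝ := min ε 1 with hε'
  have hε'0 : 0 < ε' := lt_min hε one_pos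
  have hε'1 : ε' ≤ 1 := min_le_right _ _
  have hε'ε : ε' ≤ ε := min_le_left _ _
  obtain ⟨Δ, hΔ, κ, hκ, n₀, H⟩ := exists_good_tuple hε'0 hε'1
  refine ⟨κ / 32, by positivity, max n₀ ⌈128 / κ⌉₊, fun n hn => ?_⟩
  have hn₀ : n₀ ≤ n := le_of_max_le_left hn
  have hκn : 128 ≤ κ * n := by
    have h1 : (⌈128 / κ⌉₊ : ℝ) ≤ n := by exact_mod_cast le_of_max_le_right hn
    have h2 : 128 / κ ≤ n := (Nat.le_ceil _).trans h1
    rwa [div_le_iff₀ hκ, mul_comm] at h2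
  obtain ⟨hN2, hd2, hdN⟩ := degree_bookkeeping hκ (by linarith)
  obtain ⟨ω, hexp, hsat, -⟩ := H n hn₀
  have hn1 : 1 ≤ n := by
    by_contra h; push Not at h
    have : n = 0 := by omega
    rw [this] at hκn; simp at hκn; linarith
  have hm : 0 < Δ * n := Nat.mul_pos (by omega) (by omega)
  set d : ℕ := ⌊κ / 32 * n⌋₊ with hddef
  have hd3 : 3 ≤ d := by
    refine Nat.le_floor ?_; push_cast; nlinarith
  have hdle : (d : ℝ) ≤ 1 / 2 * ((⌊κ * n⌋₊ : ℕ) : ℝ) / 2 := by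
    have : (d : ℝ) ≤ ((2 * d : ℕ) : ℝ) := by push_cast; linarith
    exact this.trans hdN
  refine ⟨satInstance ω hm, fun x => ?_, fun c hc hsos => ?_⟩
  · -- soundness: `opt ≤ 7/8 + ε`
    rw [satInstance_val ω hm x (extAssign x) (fun v h => extAssign_of_lt x h)]
    have hmr : (0 : ℝ) < (Δ * n : ℕ) := by exact_mod_cast hm
    rw [div_le_iff₀ (by exact_mod_cast hm)]
    calc _ ≤ (7 / 8 + ε') * (Δ * n : ℕ) := hsat x
      _ ≤ (7 / 8 + ε) * (Δ * n : ℕ) := by push_cast; gcongr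
      _ = (7 / 8 + ε) * ((Δ * n : ℕ) : ℝ) := by push_cast; ring
  · -- completeness for the pseudo-density: no certificate below `1`
    have hvec := vecExpands_tupleVecs ω hexp
    have hb : ∀ i, tupleSatSigns ω i * tupleSatSigns ω i = 1 := fun i => clauseSign_mul_self _
    have hD := isPseudoDensity_gsDensity (n := n) (b := tupleSatSigns ω) hvec (by norm_num) hdle
      (by linarith) hb
    have h0 := hD.cubeExpect_mul_nonneg hsos
    rw [cubeExpect_mul_sub, cubeExpect_mul_const, hD.1,
      cubeExpect_gsDensity_mul_satInstance_val ω hm hexp hN2 hdle hd3] at h0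
    linarith

/-- **Grigoriev 2001 / Schoenebeck 2008 (as restated in Kothari–Meka–Raghavendra 2017, Thm 7.5):
linear-round Sherali–Adams does not beat `1/2` on Max-3XOR — PROVED.** For every `ε > 0` there
are `c_ε > 0` and `n₀` such that for every `n ≥ n₀` the degree-`⌊c_ε n⌋` Sherali–Adams relaxation
fails to achieve a `(1 − ε, 1/2 + ε)`-approximation for Max-3XOR on `n` variables. Proof: the good
clause tuple's 3XOR instance has `opt ≤ 1/2 + ε`, the Grigoriev–Schoenebeck pseudo-density of
degree `2d` gives it value `1`, so no degree-`2d` certificate of `(1 − ε) − ℑ` exists, hence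
(`SAAchieves.achievesApprox`, KMR Fact 3.4) degree-`d` Sherali–Adams has value `> 1 − ε` on it.
[cite: FlemingKothariPitassi2019, §5.1 (Thm 5.2, p. 153: "implies the same lower bound for SA")]
[cite: KothariMekaRaghavendra2017, Thm 7.5 (p. 21)] -/
theorem Schoenebeck2008_maxThreeXorSA_holds : Schoenebeck2008_maxThreeXorSA := by
  intro ε hε
  classical
  set ε' : ℝ := min ε 1 with hε'
  have hε'0 : 0 < ε' := lt_min hε one_pos
  have hε'1 : ε' ≤ 1 := min_le_right _ _
  have hε'ε : ε' ≤ ε := min_le_left _ _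
  obtain ⟨Δ, hΔ, κ, hκ, n₀, H⟩ := exists_good_tuple hε'0 hε'1
  refine ⟨κ / 32, by positivity, max n₀ ⌈128 / κ⌉₊, fun n hn hSA => ?_⟩
  have hn₀ : n₀ ≤ n := le_of_max_le_left hn
  have hκn : 128 ≤ κ * n := by
    have h1 : (⌈128 / κ⌉₊ : ℝ) ≤ n := by exact_mod_cast le_of_max_le_right hn
    have h2 : 128 / κ ≤ n := (Nat.le_ceil _).trans h1
    rwa [div_le_iff₀ hκ, mul_comm] at h2
  obtain ⟨hN2, hd2, hdN⟩ := degree_bookkeeping hκ (by linarith)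
  obtain ⟨ω, hexp, -, hxor⟩ := H n hn₀
  have hn1 : 1 ≤ n := by
    by_contra h; push Not at h
    have : n = 0 := by omega
    rw [this] at hκn; simp at hκn; linarith
  have hm : 0 < Δ * n := Nat.mul_pos (by omega) (by omega)
  set d : ℕ := ⌊κ / 32 * n⌋₊ with hddef
  have hd3 : 3 ≤ 2 * d := by omega
  -- the 3XOR instance and its soundness
  have hopt : (xorInstance ω hm).OptLE (1 / 2 + ε) := by
    intro x
    rw [xorInstance_val ω hm x, div_le_iff₀ (by exact_mod_cast hm)]
    calc _ ≤ (1 / 2 + ε') * (Δ * n : ℕ) := hxor x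
      _ ≤ (1 / 2 + ε) * (Δ * n : ℕ) := by push_cast; gcongr
      _ = (1 / 2 + ε) * ((Δ * n : ℕ) : ℝ) := by push_cast; ring
  -- Sherali–Adams ⇒ subspace sos of degree `d` ⇒ certificate of degree `2d`
  have hsub : SubspaceSos (degreeLE n ((2 * d) / 2)) (xorInstance ω hm).val (1 - ε) := by
    rw [Nat.mul_div_cancel_left d two_pos]
    exact hSA.achievesApprox (xorInstance ω hm) hopt
  rw [subspaceSos_degreeLE_iff] at hsub
  -- the pseudo-density of degree `2d`
  have hvec := vecExpands_tupleVecs ω hexp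
  have hb : ∀ i, tupleXorSigns ω i * tupleXorSigns ω i = 1 := fun i => xorSign_mul_self _
  have hD := isPseudoDensity_gsDensity (n := n) (b := tupleXorSigns ω) (d := 2 * d) hvec
    (by norm_num) hdN (by linarith) hb
  have h0 := hD.cubeExpect_mul_nonneg hsub
  rw [cubeExpect_mul_sub, cubeExpect_mul_const, hD.1,
    cubeExpect_gsDensity_mul_xorInstance_val ω hm hexp hN2 hdN hd3] at h0
  linarith

end Literature.Combinatorics.Optimization
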